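import Literature.NumberTheory.ComplexMultiplication.CMOrderPEquivalenceLocalIsomorphism
import Literature.NumberTheory.ComplexMultiplication.CMOrderWeakClassesCount
import HarnessLib

/-!
# The monoids `W(R)`, `W_𝔭(R)`, `W_𝒮(R)`: weak equivalence and `𝔭`-equivalence are congruences for ideal
# multiplication, and `𝔭`-equivalence is an equivalence relation (Marseglia 2019 §4; Marseglia 2025 §3)

Family `hodge`, lane `lit-hodgefound` (Track 2 foundations library; seat p15, row g26-#19), topic
`Literature/NumberTheory/ComplexMultiplication`, namespaces `Literature.NumberTheory.ComplexMultiplication.NumberRing` (§1: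
any domain `R` with fraction field `K`), `…EndOrder` (§2) and `…CMTypeLattice` (§3: the order `𝔯 = endOrder (M_μ)`, where
`𝔭`-equivalence is local isomorphism at `𝔭`, `CMOrderPEquivalenceLocalIsomorphism`).  THEOREMS ONLY: no definition, no
instance, no named fact (net Literature debt `0`).  Vocabulary: `(I:J) = I / J`; weak equivalence is `1 ∈ (I:J)(J:I)`
(symmetric: `CMOrderWeakEquivalence.one_mem_div_mul_div_comm`; transitive: `CMOrderWeakClassesCount.one_mem_div_mul_div_trans`);
`𝔭`-equivalence is `1 ∈ (I:J)(J:I) + 𝔭` (Marseglia 2025 Prop. 3.2 (4)); `R_𝔭 = Localization.subalgebra.ofField K 𝔭.primeCompl _`,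
`I_𝔭 = span R_𝔭 ↑I`.

## Sources, VERBATIM

S. Marseglia, *Computing the ideal class monoid of an order*, J. Lond. Math. Soc. (2) 101 (2020) 984–1007
[Marseglia2019] (arXiv:1805.09671, held `paper:arxiv-1805.09671`, chunk p0008): "Definition 4.2. If two fractional
`R`-ideals `I` and `J` satisfy the equivalent conditions of Proposition 4.1 we say that they are weakly equivalent. Denote
by `Wk(R)` the set of weak equivalence classes … Note that `Wk(R)` inherits the structure of a commutative monoid from
`𝓘(R)`."
S. Marseglia, *Local isomorphism classes of fractional ideals of orders in étale algebras*, J. Algebra 673 (2025) 77–102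
[Marseglia2025LocalIsomorphism] (arXiv:2311.18571, held `paper:arxiv-2311.18571`, chunk p0007): "Since `𝔭`-equivalence,
`𝒮`-equivalence and weak equivalence are compatible with ideal multiplication, we get that `W_𝔭(R)`, `W_𝒮(R)` and `W(R)`
inherit the structure of commutative monoids, where the neutral element is the class of `R`."
(`CMOrderWeakClassesCount` records «NOT formalised: the monoid structure of `Wk(R)`»; this file supplies it.)

## What is formalised

* §1 (any domain): **`div_mul_div_le_div_mul`** (`(I:I′)(J:J′) ⊆ (IJ:I′J′)`), **`one_mem_div_mul_div_mul_mul`** (weak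
  equivalence is compatible with multiplication), **`one_mem_div_mul_div_add_coeIdeal_refl`**, **`…_comm`**
  (`𝔭`-equivalence is reflexive and symmetric); the local algebra of Prop. 3.2 (2):
  `span_coe_mul_eq_span_singleton_mul_of_span_coe_eq` (`I_𝔭 = xI′_𝔭`, `J_𝔭 = yJ′_𝔭 ⟹ (IJ)_𝔭 = xy(I′J′)_𝔭`),
  `span_coe_eq_span_singleton_mul_trans`, `span_coe_eq_span_singleton_inv_mul_of_span_coe_eq`.
* §2 (`𝔯 = endOrder ρ`): `EndOrder.one_mem_div_mul_div_mul_mul`.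
* §3 (`𝔯 = endOrder (M_μ)`): **`one_mem_div_mul_div_add_coeIdeal_trans`** (`𝔭`-equivalence is transitive),
  **`one_mem_div_mul_div_add_coeIdeal_mul_mul`** (compatible with multiplication: `W_𝔭(R)` is a monoid),
  **`forall_one_mem_div_mul_div_add_coeIdeal_mul_mul`** (the same for `𝒮`-equivalence).
-/

open scoped nonZeroDivisors NumberField
open Module FractionalIdeal NumberField

namespace Literature.NumberTheory.ComplexMultiplication

namespace NumberRing

/-! ## §1 Any domain -/

section AnyDomain

variable {R : Type*} [CommRing R] [IsDomain R] {K : Type*} [Field K] [Algebra R K] [IsFractionRing R K]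

/-- The monoid of fractional ideals of a domain has no zero divisors: `I, J ≠ 0 ⟹ IJ ≠ 0` («`𝓘(R)` the commutative
monoid of fractional `R`-ideals»). [cite: Marseglia2019, §2 (ideal multiplication on `𝓘(R)`), p. 4] -/
theorem mul_ne_zero_of_ne_zero {I J : FractionalIdeal R⁰ K} (hI : I ≠ 0) (hJ : J ≠ 0) : I * J ≠ 0 := by
  obtain ⟨a, ha0, haI⟩ := exists_ne_zero_mem_isInteger hI
  obtain ⟨b, hb0, hbJ⟩ := exists_ne_zero_mem_isInteger hJ
  intro h
  have hab : algebraMap R K a * algebraMap R K b ∈ I * J := mul_mem_mul haI hbJ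
  rw [h, mem_zero_iff R⁰, ← map_mul, map_eq_zero_iff _ (IsFractionRing.injective R K)] at hab
  exact (mul_ne_zero ha0 hb0) hab

/-- **`(I:I′)(J:J′) ⊆ (IJ : I′J′)`** (`xI′ ⊆ I`, `yJ′ ⊆ J ⟹ xyI′J′ ⊆ IJ`; `I′`, `J′ ≠ 0`). [cite: Marseglia2019, §4
(after Def. 4.2: «`Wk(R)` inherits the structure of a commutative monoid from `𝓘(R)`»), p. 8] -/
theorem div_mul_div_le_div_mul {I I' J J' : FractionalIdeal R⁰ K} (hI' : I' ≠ 0) (hJ' : J' ≠ 0) :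
    I / I' * (J / J') ≤ I * J / (I' * J') := by
  refine (le_div_iff_mul_le (mul_ne_zero_of_ne_zero hI' hJ')).2 ?_
  rw [mul_mul_mul_comm]
  exact mul_le_mul' ((le_div_iff_mul_le hI').1 le_rfl) ((le_div_iff_mul_le hJ').1 le_rfl)

/-- **Weak equivalence is compatible with ideal multiplication** — `1 ∈ (I:I′)(I′:I)` and `1 ∈ (J:J′)(J′:J)` give
`1 ∈ (IJ:I′J′)(I′J′:IJ)`: the set `W(R)` of weak equivalence classes is a commutative monoid under ideal
multiplication. [cite: Marseglia2019, §4 (after Def. 4.2: «`Wk(R)` inherits the structure of a commutative monoid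
from `𝓘(R)`»), p. 8] [cite: Marseglia2025LocalIsomorphism, §3 («weak equivalence [is] compatible with ideal
multiplication»), p. 7] -/
theorem one_mem_div_mul_div_mul_mul {I I' J J' : FractionalIdeal R⁰ K} (hI : I ≠ 0) (hI' : I' ≠ 0) (hJ : J ≠ 0)
    (hJ' : J' ≠ 0) (h₁ : (1 : K) ∈ I / I' * (I' / I)) (h₂ : (1 : K) ∈ J / J' * (J' / J)) :
    (1 : K) ∈ I * J / (I' * J') * (I' * J' / (I * J)) := by
  have h := mul_mem_mul h₁ h₂
  rw [mul_one, mul_mul_mul_comm] at h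
  exact mul_le_mul' (div_mul_div_le_div_mul hI' hJ') (div_mul_div_le_div_mul hI hJ) h

/-- **`𝔭`-equivalence is reflexive: `1 ∈ (I:I)(I:I) + 𝔞`** (`I ≠ 0`, any ideal `𝔞`). [cite: Marseglia2025LocalIsomorphism,
§3 Def. 3.1 / Prop. 3.2 (4), p. 6] -/
theorem one_mem_div_mul_div_add_coeIdeal_refl {I : FractionalIdeal R⁰ K} (hI : I ≠ 0) (𝔞 : Ideal R) :
    (1 : K) ∈ I / I * (I / I) + (𝔞 : FractionalIdeal R⁰ K) := by
  have h1 : (1 : K) ∈ I / I := (mem_div_iff_of_ne_zero hI).2 fun y hy ↦ by rwa [one_mul]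
  rw [← mem_coe, coe_add, Submodule.add_eq_sup]
  refine Submodule.mem_sup_left ?_
  have h := mul_mem_mul h1 h1
  rwa [mul_one] at h

/-- **`𝔭`-equivalence is symmetric.** [cite: Marseglia2025LocalIsomorphism, §3 Def. 3.1 / Prop. 3.2 (4), p. 6] -/
theorem one_mem_div_mul_div_add_coeIdeal_comm {I J : FractionalIdeal R⁰ K} (𝔞 : Ideal R) :
    (1 : K) ∈ I / J * (J / I) + (𝔞 : FractionalIdeal R⁰ K) ↔ (1 : K) ∈ J / I * (I / J) + (𝔞 : FractionalIdeal R⁰ K) := by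
  rw [mul_comm]

omit [IsDomain R] [IsFractionRing R K] in
/-- **Prop. 3.2 (2) is multiplicative: `I_𝔭 = x·I′_𝔭`, `J_𝔭 = y·J′_𝔭 ⟹ (IJ)_𝔭 = xy·(I′J′)_𝔭`.**
[cite: Marseglia2025LocalIsomorphism, §3 («`𝔭`-equivalence … compatible with ideal multiplication») and §2
(«`(IJ)_𝔭 = I_𝔭J_𝔭`»), pp. 5, 7] -/
theorem span_coe_mul_eq_span_singleton_mul_of_span_coe_eq (A : Subalgebra R K) {I I' J J' : FractionalIdeal R⁰ K}
    {x y : K} (hx : Submodule.span A (I : Set K) = Submodule.span A {x} * Submodule.span A (I' : Set K))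
    (hy : Submodule.span A (J : Set K) = Submodule.span A {y} * Submodule.span A (J' : Set K)) :
    Submodule.span A ((I * J : FractionalIdeal R⁰ K) : Set K) =
      Submodule.span A {x * y} * Submodule.span A ((I' * J' : FractionalIdeal R⁰ K) : Set K) := by
  rw [span_coe_mul, hx, hy, span_coe_mul, mul_mul_mul_comm, Submodule.span_mul_span, Set.singleton_mul_singleton]

omit [IsDomain R] [IsFractionRing R K] in
/-- **Prop. 3.2 (2) is transitive: `I_𝔭 = x·J_𝔭`, `J_𝔭 = y·L_𝔭 ⟹ I_𝔭 = xy·L_𝔭`.** [cite: Marseglia2025LocalIsomorphism,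
§3 Def. 3.1 («`𝔭`-equivalent if `I_𝔭 ≃ J_𝔭`», an equivalence relation), p. 6] -/
theorem span_coe_eq_span_singleton_mul_trans (A : Subalgebra R K) {I J L : FractionalIdeal R⁰ K} {x y : K}
    (hx : Submodule.span A (I : Set K) = Submodule.span A {x} * Submodule.span A (J : Set K))
    (hy : Submodule.span A (J : Set K) = Submodule.span A {y} * Submodule.span A (L : Set K)) :
    Submodule.span A (I : Set K) = Submodule.span A {x * y} * Submodule.span A (L : Set K) := by
  rw [hx, hy, ← mul_assoc, Submodule.span_mul_span, Set.singleton_mul_singleton]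

omit [IsDomain R] [IsFractionRing R K] in
/-- **Prop. 3.2 (2) is symmetric: `I_𝔭 = x·J_𝔭` (`x ≠ 0`) `⟹ J_𝔭 = x⁻¹·I_𝔭`.** [cite: Marseglia2025LocalIsomorphism, §3
Def. 3.1 / Prop. 3.2 (2), p. 6] -/
theorem span_coe_eq_span_singleton_inv_mul_of_span_coe_eq (A : Subalgebra R K) {I J : FractionalIdeal R⁰ K} {x : K}
    (hx0 : x ≠ 0) (hx : Submodule.span A (I : Set K) = Submodule.span A {x} * Submodule.span A (J : Set K)) :
    Submodule.span A (J : Set K) = Submodule.span A {x⁻¹} * Submodule.span A (I : Set K) := by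
  rw [hx, ← mul_assoc, Submodule.span_mul_span, Set.singleton_mul_singleton, inv_mul_cancel₀ hx0,
    ← Submodule.one_eq_span, one_mul]

end AnyDomain

end NumberRing

/-! ## §2 The order `𝔯 = endOrder ρ`: `W(𝔯)` is a monoid -/

namespace EndOrder

variable {K : Type} [Field K] [NumberField K]
variable {ι : Type} [Fintype ι] [DecidableEq ι] {ρ : K →ₐ[ℚ] Matrix ι ι ℚ}
variable [IsFractionRing (endOrder ρ) K]

/-- **`Wk(𝔯)` is a commutative monoid under ideal multiplication** (weak equivalence is a congruence; with
`one_mem_div_mul_div_comm`, `one_mem_div_mul_div_trans` of `CMOrderWeakEquivalence` / `CMOrderWeakClassesCount`).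
[cite: Marseglia2019, §4 (after Def. 4.2), p. 8] -/
theorem one_mem_div_mul_div_mul_mul {I I' J J' : FractionalIdeal (endOrder ρ)⁰ K} (hI : I ≠ 0) (hI' : I' ≠ 0)
    (hJ : J ≠ 0) (hJ' : J' ≠ 0) (h₁ : (1 : K) ∈ I / I' * (I' / I)) (h₂ : (1 : K) ∈ J / J' * (J' / J)) :
    (1 : K) ∈ I * J / (I' * J') * (I' * J' / (I * J)) :=
  NumberRing.one_mem_div_mul_div_mul_mul hI hI' hJ hJ' h₁ h₂

end EndOrder

/-! ## §3 The order `𝔯 = endOrder (M_μ)`: `W_𝔭(𝔯)` and `W_𝒮(𝔯)` are monoids; `𝔭`-equivalence is transitive -/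

namespace CMTypeLattice

variable {K : Type} [Field K] [NumberField K]
variable {ι : Type} [Fintype ι] [DecidableEq ι] [Nonempty ι] (μ : Basis ι ℚ K)
variable [IsFractionRing (endOrder (Algebra.leftMulMatrix μ)) K]

/-- **`𝔭`-equivalence is transitive** (via Prop. 3.2 (4) ⟺ (2): `I_𝔭 = xJ_𝔭`, `J_𝔭 = yL_𝔭 ⟹ I_𝔭 = xyL_𝔭`), for the order
`𝔯 = endOrder (M_μ)` and a maximal `𝔭`. [cite: Marseglia2025LocalIsomorphism, §3 Def. 3.1 and Prop. 3.2 ((2) ⟺ (4)), p. 6] -/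
theorem one_mem_div_mul_div_add_coeIdeal_trans {I J L : FractionalIdeal (endOrder (Algebra.leftMulMatrix μ))⁰ K}
    (hI : I ≠ 0) (hJ : J ≠ 0) (hL : L ≠ 0) (𝔭 : Ideal (endOrder (Algebra.leftMulMatrix μ))) [𝔭.IsMaximal]
    (h₁ : (1 : K) ∈ I / J * (J / I) + (𝔭 : FractionalIdeal (endOrder (Algebra.leftMulMatrix μ))⁰ K))
    (h₂ : (1 : K) ∈ J / L * (L / J) + (𝔭 : FractionalIdeal (endOrder (Algebra.leftMulMatrix μ))⁰ K)) :
    (1 : K) ∈ I / L * (L / I) + (𝔭 : FractionalIdeal (endOrder (Algebra.leftMulMatrix μ))⁰ K) := by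
  haveI := isNoetherianRing_endOrder (Algebra.leftMulMatrix μ)
  obtain ⟨x, -, hx⟩ := exists_ne_zero_span_coe_eq_of_one_mem_add_coeIdeal μ hI hJ 𝔭 h₁
  obtain ⟨y, -, hy⟩ := exists_ne_zero_span_coe_eq_of_one_mem_add_coeIdeal μ hJ hL 𝔭 h₂
  exact NumberRing.one_mem_add_coeIdeal_of_span_coe_eq hI hL 𝔭 (NumberRing.span_coe_eq_span_singleton_mul_trans _ hx hy)

/-- **`𝔭`-equivalence is compatible with ideal multiplication: `W_𝔭(𝔯)` is a commutative monoid** (`I ~_𝔭 I′`,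
`J ~_𝔭 J′ ⟹ IJ ~_𝔭 I′J′`). [cite: Marseglia2025LocalIsomorphism, §3 («`𝔭`-equivalence … compatible with ideal
multiplication … `W_𝔭(R)` … commutative monoids»), p. 7] -/
theorem one_mem_div_mul_div_add_coeIdeal_mul_mul {I I' J J' : FractionalIdeal (endOrder (Algebra.leftMulMatrix μ))⁰ K}
    (hI : I ≠ 0) (hI' : I' ≠ 0) (hJ : J ≠ 0) (hJ' : J' ≠ 0) (𝔭 : Ideal (endOrder (Algebra.leftMulMatrix μ))) [𝔭.IsMaximal]
    (h₁ : (1 : K) ∈ I / I' * (I' / I) + (𝔭 : FractionalIdeal (endOrder (Algebra.leftMulMatrix μ))⁰ K))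
    (h₂ : (1 : K) ∈ J / J' * (J' / J) + (𝔭 : FractionalIdeal (endOrder (Algebra.leftMulMatrix μ))⁰ K)) :
    (1 : K) ∈ I * J / (I' * J') * (I' * J' / (I * J)) + (𝔭 : FractionalIdeal (endOrder (Algebra.leftMulMatrix μ))⁰ K) := by
  haveI := isNoetherianRing_endOrder (Algebra.leftMulMatrix μ)
  obtain ⟨x, -, hx⟩ := exists_ne_zero_span_coe_eq_of_one_mem_add_coeIdeal μ hI hI' 𝔭 h₁
  obtain ⟨y, -, hy⟩ := exists_ne_zero_span_coe_eq_of_one_mem_add_coeIdeal μ hJ hJ' 𝔭 h₂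
  exact NumberRing.one_mem_add_coeIdeal_of_span_coe_eq (EndOrder.fractionalIdeal_mul_ne_zero hI hJ)
    (EndOrder.fractionalIdeal_mul_ne_zero hI' hJ') 𝔭 (NumberRing.span_coe_mul_eq_span_singleton_mul_of_span_coe_eq _ hx hy)

/-- **`𝒮`-equivalence is compatible with ideal multiplication: `W_𝒮(𝔯)` is a commutative monoid** (any set `𝒮` of
maximal ideals). [cite: Marseglia2025LocalIsomorphism, §3 Def. 3.3 and the paragraph on `W_𝒮(R)`, pp. 6–7] -/
theorem forall_one_mem_div_mul_div_add_coeIdeal_mul_mul {I I' J J' : FractionalIdeal (endOrder (Algebra.leftMulMatrix μ))⁰ K}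
    (hI : I ≠ 0) (hI' : I' ≠ 0) (hJ : J ≠ 0) (hJ' : J' ≠ 0)
    (𝒮 : Set (MaximalSpectrum (endOrder (Algebra.leftMulMatrix μ))))
    (h₁ : ∀ 𝔭 ∈ 𝒮, (1 : K) ∈ I / I' * (I' / I) + (𝔭.asIdeal : FractionalIdeal (endOrder (Algebra.leftMulMatrix μ))⁰ K))
    (h₂ : ∀ 𝔭 ∈ 𝒮, (1 : K) ∈ J / J' * (J' / J) + (𝔭.asIdeal : FractionalIdeal (endOrder (Algebra.leftMulMatrix μ))⁰ K)) :
    ∀ 𝔭 ∈ 𝒮, (1 : K) ∈ I * J / (I' * J') * (I' * J' / (I * J)) +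
      (𝔭.asIdeal : FractionalIdeal (endOrder (Algebra.leftMulMatrix μ))⁰ K) := fun 𝔭 h𝔭 ↦ by
  haveI := 𝔭.isMaximal
  exact one_mem_div_mul_div_add_coeIdeal_mul_mul μ hI hI' hJ hJ' 𝔭.asIdeal (h₁ 𝔭 h𝔭) (h₂ 𝔭 h𝔭)

end CMTypeLattice

end Literature.NumberTheory.ComplexMultiplication
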